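import Literature.Analysis.ValidatedNumerics.FixedPointInterval
import HarnessLib

/-!
# `cos`/`sin` enclosures, logarithm tables and rational conveniences over `Literature.Numerics`

Trunk T-VALNUM (`Literature/Analysis/ValidatedNumerics`). Small additions to the kernel-evaluable
fixed-point engine `FixedPointInterval.lean` (`Literature.Analysis.ValidatedNumerics.Numerics.FI`, `Literature.Analysis.ValidatedNumerics.Numerics.CB`, scale `2^48`)
needed by the certificate checker for the argument of `ζ`
(`Literature/NumberTheory/LFunctions/ZetaArgumentCertificate.lean`): everything here is a
corollary of the engine's inclusion theorems.

* `FI.pow` (`mem_pow`), `FI.ofRat`, `FI.ofRatRat` (`mem_ofRat`, `mem_ofRatRat`), `FI.widenQ`,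
  `CB.widenQ` (widening by a rational error bound, `mem_widenQ`), `FI.loQ`, `FI.hiQ`, `FI.absHiQ`
  (end points as rationals: `loQ_le`, `le_hiQ`, `abs_le_absHiQ`); `FI.mem_zero`, `FI.mem_one`,
  `CB.mem_zero` (membership of `0`, `1` in the engine's `ofInt 0`, `ofInt 1`).
* `FI.cosSin Θ` — enclosures of `cos θ`, `sin θ` for `θ ∈ Θ`, read off `CB.expI`
  (`CB.mem_expI`): `FI.mem_cosSin`.
* `FI.logTable N : List FI` with validity flag `FI.logTableOK N` — the table
  `log 0 = 0, log 1 = 0, log 2, …, log N` built from `log n = log (n-1) - log (1 - 1/n)` and the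
  engine's `FI.logOneSub` (`FI.mem_logOneSub`): `FI.mem_logTable`.

-/

open Real

namespace Literature.Analysis.ValidatedNumerics.Numerics

namespace FI

variable {x y : ℝ} {I J : FI}

/-- `0 ∈ ofInt 0`. [folklore] -/
theorem mem_zero : mem 0 (ofInt 0) := by simpa using mem_ofInt 0

/-- `1 ∈ ofInt 1`. [folklore] -/
theorem mem_one : mem 1 (ofInt 1) := by simpa using mem_ofInt 1

/-- Powers by repeated multiplication (`pow I 0 = ofInt 1`). [folklore] -/
def pow (I : FI) : ℕ → FI
  | 0 => ofInt 1
  | n + 1 => mul (pow I n) I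

/-- Inclusion property of `pow`. [folklore] -/
theorem mem_pow (hx : mem x I) : ∀ n : ℕ, mem (x ^ n) (pow I n)
  | 0 => by simpa [pow] using mem_one
  | n + 1 => by rw [pow_succ]; exact mem_mul (mem_pow hx n) hx

/-- Enclosure of a rational number. [folklore] -/
def ofRat (q : ℚ) : FI := ofFrac q.num q.den

/-- `q ∈ ofRat q`. [folklore] -/
theorem mem_ofRat (q : ℚ) : mem (q : ℝ) (ofRat q) := by
  have h := mem_ofFrac q.num q.den_pos
  rw [ofRat]
  convert h using 1
  rw [Rat.cast_def]

/-- The interval `[⌊p⌋, ⌈q⌉]` (at scale `2^48`) for rationals `p ≤ q`. [folklore] -/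
def ofRatRat (p q : ℚ) : FI := ⟨⌊p * SC⌋, ⌈q * SC⌉⟩

/-- `[p, q] ⊆ ofRatRat p q`. [folklore] -/
theorem mem_ofRatRat {p q : ℚ} (h1 : (p : ℝ) ≤ x) (h2 : x ≤ q) : mem x (ofRatRat p q) := by
  have hS := SC_pos
  constructor
  · have h : ((⌊p * SC⌋ : ℤ) : ℚ) ≤ p * SC := Int.floor_le _
    have h' : (((⌊p * SC⌋ : ℤ) : ℚ) : ℝ) ≤ ((p * SC : ℚ) : ℝ) := by exact_mod_cast h
    push_cast at h'
    show ((⌊p * SC⌋ : ℤ) : ℝ) ≤ x * SC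
    nlinarith
  · have h : q * SC ≤ ((⌈q * SC⌉ : ℤ) : ℚ) := Int.le_ceil _
    have h' : ((q * SC : ℚ) : ℝ) ≤ (((⌈q * SC⌉ : ℤ) : ℚ) : ℝ) := by exact_mod_cast h
    push_cast at h'
    show x * SC ≤ ((⌈q * SC⌉ : ℤ) : ℝ)
    nlinarith

/-- Widening by a rational (absolute) error bound `e`. [folklore] -/
def widenQ (I : FI) (e : ℚ) : FI := I.widen ⌈e * SC⌉

/-- If `x ∈ I` and `|x' - x| ≤ e` then `x' ∈ widenQ I e`. [folklore] -/
theorem mem_widenQ (hx : mem x I) {x' : ℝ} {e : ℚ} (he : |x' - x| ≤ e) : mem x' (widenQ I e) := by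
  refine mem_widen hx ?_
  have h : ((e * SC : ℚ) : ℝ) ≤ (((⌈e * SC⌉ : ℤ) : ℚ) : ℝ) := by exact_mod_cast Int.le_ceil _
  push_cast at h
  exact le_trans (mul_le_mul_of_nonneg_right he SC_pos.le) h

/-- Lower end point as a rational number. [folklore] -/
def loQ (I : FI) : ℚ := I.lo / SC

/-- Upper end point as a rational number. [folklore] -/
def hiQ (I : FI) : ℚ := I.hi / SC

/-- `max(|lo|, |hi|)/2^48`, an upper bound for `|x|`, `x ∈ I`, as a rational. [folklore] -/
def absHiQ (I : FI) : ℚ := I.absHi / SC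

/-- `loQ I ≤ x` for `x ∈ I`. [folklore] -/
theorem loQ_le (hx : mem x I) : (I.loQ : ℝ) ≤ x := by
  have := lo_div_le hx
  simpa [loQ] using this

/-- `x ≤ hiQ I` for `x ∈ I`. [folklore] -/
theorem le_hiQ (hx : mem x I) : x ≤ (I.hiQ : ℝ) := by
  have := le_hi_div hx
  simpa [hiQ] using this

/-- `|x| ≤ absHiQ I` for `x ∈ I`. [folklore] -/
theorem abs_le_absHiQ (hx : mem x I) : |x| ≤ (I.absHiQ : ℝ) := by
  have h := abs_le_absHi hx
  simp only [absHiQ, Rat.cast_div, Rat.cast_intCast, Rat.cast_natCast]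
  rw [le_div_iff₀ SC_pos]
  exact h

/-- A number of absolute value `≤ 1` lies in `[-1, 1]`. [folklore] -/
theorem mem_trivial_of_abs_le_one (hx : |x| ≤ 1) : mem x ⟨-SC, SC⟩ := by
  rw [abs_le] at hx
  have hd := SC_pos
  constructor
  · push_cast; nlinarith
  · push_cast; nlinarith

/-- **`cos` and `sin` of an interval**, read off the engine's `e^{iθ}` enclosure `CB.expI`
(the trivial enclosure `[-1, 1]` if the engine declines). [folklore] -/
def cosSin (Θ : FI) : FI × FI :=
  match CB.expI Θ with
  | some B => (B.re, B.im)
  | none => (⟨-SC, SC⟩, ⟨-SC, SC⟩)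

/-- **Soundness of `cosSin`** (`CB.mem_expI`, `e^{iθ} = cos θ + i sin θ`). [folklore] -/
theorem mem_cosSin {θ : ℝ} {Θ : FI} (h : mem θ Θ) :
    mem (Real.cos θ) (cosSin Θ).1 ∧ mem (Real.sin θ) (cosSin Θ).2 := by
  unfold cosSin
  split
  · rename_i B hB
    have hm := CB.mem_expI hB h
    exact ⟨by simpa [Complex.exp_ofReal_mul_I_re] using hm.1,
      by simpa [Complex.exp_ofReal_mul_I_im] using hm.2⟩
  · exact ⟨mem_trivial_of_abs_le_one (Real.abs_cos_le_one θ),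
      mem_trivial_of_abs_le_one (Real.abs_sin_le_one θ)⟩

/-! ### Logarithms of natural numbers -/

/-- Number of series terms used for the logarithms (tail `≤ 2 · 2⁻⁵¹`). [folklore] -/
def logTerms : ℕ := 50

/-- Total version of the engine's `logOneSub` (junk `ofInt 0` when the engine declines; use
together with `logOneSubOK`). [folklore] -/
def logOneSubD (X : FI) (K : ℕ) : FI := (logOneSub X K).getD (ofInt 0)

/-- Did the engine accept the input of `logOneSubD`? [folklore] -/
def logOneSubOK (X : FI) (K : ℕ) : Bool := (logOneSub X K).isSome

/-- Soundness of `logOneSubD` (`FI.mem_logOneSub`). [folklore] -/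
theorem mem_logOneSubD {X : FI} {K : ℕ} (hok : logOneSubOK X K = true) (hx : mem x X) :
    mem (Real.log (1 - x)) (logOneSubD X K) := by
  obtain ⟨Y, hY⟩ := Option.isSome_iff_exists.1 hok
  rw [logOneSubD, hY, Option.getD_some]
  exact mem_logOneSub hY hx

/-- Auxiliary for `logTable`: given the table up to `n` (last entry `cur ∋ log n`), append the
entries for `n+1, …, n+j`, using `log m = log (m-1) - log (1 - 1/m)`. [folklore] -/
def logTableAux : ℕ → ℕ → FI → List FI → List FI
  | 0, _, _, acc => acc
  | j + 1, n, cur, acc =>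
    let nxt := cur.sub (logOneSubD (ofFrac 1 (n + 1)) logTerms)
    logTableAux j (n + 1) nxt (acc ++ [nxt])

/-- The engine accepted every step of `logTableAux`. [folklore] -/
def logTableOKAux : ℕ → ℕ → Bool
  | 0, _ => true
  | j + 1, n => logOneSubOK (ofFrac 1 (n + 1)) logTerms && logTableOKAux j (n + 1)

/-- The table `[I₀, I₁, …, I_N]` with `log n ∈ I_n` (`I₀ = I₁ = [0,0]`; `log 0 = 0` in Mathlib),
valid when `logTableOK N`. [folklore] -/
def logTable (N : ℕ) : List FI := logTableAux (N - 1) 1 (ofInt 0) [ofInt 0, ofInt 0]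

/-- Validity flag of `logTable N`. [folklore] -/
def logTableOK (N : ℕ) : Bool := logTableOKAux (N - 1) 1

/-- `log (n+1) = log n - log (1 - 1/(n+1))` in the engine. [folklore] -/
theorem mem_log_succ {n : ℕ} (hn : 1 ≤ n) {cur : FI} (hcur : mem (Real.log n) cur)
    (hok : logOneSubOK (ofFrac 1 (n + 1)) logTerms = true) :
    mem (Real.log ((n + 1 : ℕ) : ℝ)) (cur.sub (logOneSubD (ofFrac 1 (n + 1)) logTerms)) := by
  have hfrac : mem ((1 : ℝ) / (n + 1 : ℕ)) (ofFrac 1 (n + 1)) := by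
    have := mem_ofFrac 1 (q := n + 1) (by omega)
    simpa using this
  have hlog1 := mem_logOneSubD hok hfrac
  have hn0 : (0 : ℝ) < n := by exact_mod_cast (show 0 < n by omega)
  have hn1 : (0 : ℝ) < (n + 1 : ℕ) := by positivity
  have heq : Real.log ((n + 1 : ℕ) : ℝ) = Real.log n - Real.log (1 - 1 / (n + 1 : ℕ)) := by
    rw [show (1 : ℝ) - 1 / (n + 1 : ℕ) = n / (n + 1 : ℕ) by push_cast; field_simp; ring,
      Real.log_div hn0.ne' hn1.ne']
    ring
  rw [heq]
  exact mem_sub hcur hlog1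

/-- Invariant of `logTableAux`. [folklore] -/
theorem logTableAux_spec (j : ℕ) : ∀ (n : ℕ), 1 ≤ n → ∀ (cur : FI) (acc : List FI),
    mem (Real.log n) cur → acc.length = n + 1 →
    (∀ i ≤ n, mem (Real.log i) (acc.getD i (ofInt 0))) → logTableOKAux j n = true →
    ∀ i ≤ n + j, mem (Real.log i) ((logTableAux j n cur acc).getD i (ofInt 0)) := by
  induction j with
  | zero =>
    intro n _ cur acc _ _ hacc _
    simpa [logTableAux] using hacc
  | succ j ih =>
    intro n hn cur acc hcur hlen hacc hok i hi
    simp only [logTableOKAux, Bool.and_eq_true] at hok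
    simp only [logTableAux]
    have hnxt := mem_log_succ hn hcur hok.1
    refine ih (n + 1) (by omega) _ _ hnxt (by simp [hlen]) ?_ hok.2 i (by omega)
    intro i' hi'
    rcases Nat.lt_or_ge i' (n + 1) with hlt | hge
    · rw [List.getD_eq_getElem?_getD, List.getElem?_append_left (by omega),
        ← List.getD_eq_getElem?_getD]
      exact hacc i' (by omega)
    · have : i' = n + 1 := by omega
      subst this
      rw [List.getD_eq_getElem?_getD, List.getElem?_append_right (by omega)]
      simpa [hlen] using hnxt

/-- **Soundness of the logarithm table.** [folklore] -/
theorem mem_logTable {N n : ℕ} (hok : logTableOK N = true) (hn : n ≤ N) :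
    mem (Real.log n) ((logTable N).getD n (ofInt 0)) := by
  unfold logTable
  unfold logTableOK at hok
  have base : ∀ i : ℕ, i ≤ 1 → mem (Real.log i) (([ofInt 0, ofInt 0] : List FI).getD i (ofInt 0)) := by
    intro i hi
    have : i = 0 ∨ i = 1 := by omega
    rcases this with rfl | rfl <;> simpa using mem_zero
  have h0 : mem (Real.log (1 : ℕ)) (ofInt 0) := by simpa using mem_zero
  exact logTableAux_spec (N - 1) 1 le_rfl (ofInt 0) [ofInt 0, ofInt 0] h0 rfl base hok n (by omega)

end FI

namespace CB

variable {z : ℂ} {A : CB}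

/-- `0 ∈ ofInt 0`. [folklore] -/
theorem mem_zero : mem 0 (ofInt 0) := by simpa using mem_ofInt 0

/-- Widening both coordinates by a rational (absolute) error bound. [folklore] -/
def widenQ (A : CB) (e : ℚ) : CB := ⟨A.re.widenQ e, A.im.widenQ e⟩

/-- If `z ∈ A` and `|w - z| ≤ e` then `w ∈ widenQ A e`. [folklore] -/
theorem mem_widenQ (hz : mem z A) {w : ℂ} {e : ℚ} (h : ‖w - z‖ ≤ e) : mem w (widenQ A e) := by
  refine ⟨?_, ?_⟩
  · show FI.mem w.re (A.re.widenQ e)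
    refine FI.mem_widenQ hz.1 ?_
    calc |w.re - z.re| = |(w - z).re| := by simp
      _ ≤ ‖w - z‖ := Complex.abs_re_le_norm _
      _ ≤ e := h
  · show FI.mem w.im (A.im.widenQ e)
    refine FI.mem_widenQ hz.2 ?_
    calc |w.im - z.im| = |(w - z).im| := by simp
      _ ≤ ‖w - z‖ := Complex.abs_im_le_norm _
      _ ≤ e := h

end CB

end Literature.Analysis.ValidatedNumerics.Numerics
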